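import Summits.QuantumFields.BalabanUV.Beta.FP.PerfectSymbol166

/-!
# `BalabanUV.Beta.FP.PerfectSymbol166Pos` — road «FP» for binder row D1, leaf H2-P input (P-i) of the horizontal route (owner ruling R-FP-15;
# `HOME/b2b-balaban-beta-d1-p3/H2-DESIGN.md` §5): the CONTINUUM (1.66) MULTIPLIER IS TWO-SIDED BOUNDED ON THE REAL BRILLOUIN ZONE —
# `(4/π²)^{d+2} ≤ Re W_∞(μ,ν; s) ≤ (π²/4)^{2d+4}`, `Im W_∞(μ,ν; s) = 0`, every real `s ≠ 0`, `μ ≠ ν` (and `W_∞(·;0) = 1`)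

HONEST DEPENDENCY (page 1, mandatory): continuum YM on T⁴ ⇐ BetaPertH ∧ nine spine estimates (0/9 proved); BetaPertH ⇐ (D1) ∧ (D4) ∧ CAP+tail;
G-an2-4 gates asym, D1 and NE2/3/4.  HONEST FRAMING (cell contract, verbatim): «discharging `BetaPertH` makes Bałaban's UV stability UNCONDITIONAL —
a real constructive-QFT result; it is NOT the continuum limit and NOT the Clay problem.»  THIS MODULE DISCHARGES NOTHING of the wall.  It is the
`k = ∞` SHADOW of a bound the tree already PROVES at every finite level: pv-lineage `B5Bounds167Lattice.w166_bounds` («the function under the integral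
is bounded from below and above by positive constants γ₀, γ₁ dependent on d only», [Balaban1984PropagatorsI] p. 29 after (1.66) — PROVED there with our
constants, not cited), carried to the continuum multiplier `PerfectSymbol166.W166Inf` (the road's closed form, p222342) through `B5Symbol166.W166_ofReal`
(the complex symbol at a real momentum IS the printed integrand) and `PerfectSymbol166.tendsto_W166` (`le_of_tendsto`).  [our object] over tree theorems
BY NAME; no `def`, no `def … : Prop`, nothing cited as a hypothesis, 0 sorry; NOT D1, NOT BetaPertH, NOT continuum, NOT Clay.
USE (road FP, H2-P): `W_∞ ≥ (4/π²)^{d+2} > 0` on the real zone is the TRANSVERSE COERCIVITY of the perfect Laplacian's symbol (the generalised Maxwell matrix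
with plaquette weights `½W_∞(μ,ν;p)`, `EffectiveLaplacianLimit.deltaZLim`/`PerfectSymbolKMultiplierClosed.GsymInf`), i.e. the invertibility input for the
UNCONSTRAINED perfect propagator `(Δ* + slice)⁻¹` of the unconstrained perfect polarization Π (N7-PROOF.v2 (H2)); the upper bound is the boundedness input.
Provenance: road FP owner b2b-balaban-beta-d1-p3 gen 4 (prover-b2b-balaban-beta-d1-p3-g4-0), 2026-08-20.

ABSOLUTE RULE (cell charter, verbatim): «No internally-minted statement may enter as a cited fact. Every hypothesis is either kernel-proved in this package or a
verbatim quotation of a PUBLISHED theorem with page reference. The manuscript(s) under audit are NOT citable for their own disputed steps — they are the thing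
under adjudication; programme-internal (2001/route/tribunal) claims are never citable.»
-/

noncomputable section

namespace Summit.QuantumFields.BalabanUV.Beta.FP.PerfectSymbol166Pos

open Filter Topology
open Literature.MathematicalPhysics.QuantumFieldTheory.Balaban1983to89
open B4Strip (Strip ofRealVec)
open B4ContourShift (BZ ofRealVec_mem_Strip)
open B5Symbol166 (W166 W166_ofReal)
open B5Bounds167Lattice (w166 w166_bounds)
open B5Symbol166Strip (kappa166 kappa166_pos)
open Summit.QuantumFields.BalabanUV.Beta.FP.PerfectSymbol166 (W166Inf tendsto_W166 W166Inf_zero)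

variable {d : ℕ}

/-- [folklore] A point of the real Brillouin zone has all coordinates in `[−π, π]`. -/
theorem abs_le_pi_of_mem_BZ {s : Fin d → ℝ} (hs : s ∈ BZ d) (κ : Fin d) : |s κ| ≤ Real.pi :=
  abs_le.mpr ⟨hs.1 κ, hs.2 κ⟩

/-- [our object] **AT A REAL NONZERO MOMENTUM THE LEVEL-`(j+1)` MULTIPLIER IS THE PRINTED REAL INTEGRAND**: real part `= w166 (j+1) μ ν s`, imaginary part `0`
(`B5Symbol166.W166_ofReal`). -/
theorem W166_succ_ofReal (j : ℕ) {μ ν : Fin d} (hμν : μ ≠ ν) {s : Fin d → ℝ} (hs : s ∈ BZ d) (ν₀ : Fin d) (hν₀ : s ν₀ ≠ 0) :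
    (W166 (j + 1) μ ν (ofRealVec s)).re = w166 (j + 1) μ ν s ∧ (W166 (j + 1) μ ν (ofRealVec s)).im = 0 := by
  have h := W166_ofReal (j + 1) (Nat.le_add_left 1 j) hμν s (abs_le_pi_of_mem_BZ hs) ν₀ hν₀
  rw [h]
  exact ⟨Complex.ofReal_re _, Complex.ofReal_im _⟩

/-- [our object] The real parts converge: `(W^{(j+1)}_{μν}(s)).re → (W_∞(μ,ν;s)).re` on the real Brillouin zone (the zone is `Strip d 0`). -/
theorem tendsto_W166_re {s : Fin d → ℝ} (hs : s ∈ BZ d) (μ ν : Fin d) :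
    Tendsto (fun j : ℕ => (W166 (j + 1) μ ν (ofRealVec s)).re) atTop (𝓝 (W166Inf μ ν (ofRealVec s)).re) :=
  (Complex.continuous_re.tendsto _).comp (tendsto_W166 le_rfl (kappa166_pos d).le (ofRealVec_mem_Strip le_rfl hs) μ ν)

/-- [our object] … and the imaginary parts: `(W^{(j+1)}_{μν}(s)).im → (W_∞(μ,ν;s)).im`. -/
theorem tendsto_W166_im {s : Fin d → ℝ} (hs : s ∈ BZ d) (μ ν : Fin d) :
    Tendsto (fun j : ℕ => (W166 (j + 1) μ ν (ofRealVec s)).im) atTop (𝓝 (W166Inf μ ν (ofRealVec s)).im) :=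
  (Complex.continuous_im.tendsto _).comp (tendsto_W166 le_rfl (kappa166_pos d).le (ofRealVec_mem_Strip le_rfl hs) μ ν)

/-- [our object] **THE CONTINUUM MULTIPLIER IS REAL ON THE REAL ZONE** (`s ≠ 0`, `μ ≠ ν`): `Im W_∞(μ,ν; s) = 0`. -/
theorem W166Inf_ofReal_im {μ ν : Fin d} (hμν : μ ≠ ν) {s : Fin d → ℝ} (hs : s ∈ BZ d) (ν₀ : Fin d) (hν₀ : s ν₀ ≠ 0) :
    (W166Inf μ ν (ofRealVec s)).im = 0 := by
  have ht := tendsto_W166_im hs μ ν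
  have h0 : (fun j : ℕ => (W166 (j + 1) μ ν (ofRealVec s)).im) = fun _ => (0 : ℝ) :=
    funext fun j => (W166_succ_ofReal j hμν hs ν₀ hν₀).2
  rw [h0] at ht
  exact (tendsto_nhds_unique tendsto_const_nhds ht).symm

/-- [our object] **THE PRINTED TWO-SIDED BOUND AT `k = ∞`**: on the punctured real Brillouin zone, for `μ ≠ ν`,
`(4/π²)^{d+2} ≤ Re W_∞(μ,ν; s) ≤ (π²/4)^{2d+4}` — `B5Bounds167Lattice.w166_bounds` at every level `j+1` passed to the limit (`ge_of_tendsto` ∕ `le_of_tendsto`). -/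
theorem W166Inf_ofReal_re_bounds {μ ν : Fin d} (hμν : μ ≠ ν) {s : Fin d → ℝ} (hs : s ∈ BZ d) (ν₀ : Fin d) (hν₀ : s ν₀ ≠ 0) :
    (4 / Real.pi ^ 2) ^ (d + 2) ≤ (W166Inf μ ν (ofRealVec s)).re ∧ (W166Inf μ ν (ofRealVec s)).re ≤ (Real.pi ^ 2 / 4) ^ (2 * d + 4) := by
  have ht := tendsto_W166_re hs μ ν
  have hb : ∀ j : ℕ, (4 / Real.pi ^ 2) ^ (d + 2) ≤ (W166 (j + 1) μ ν (ofRealVec s)).re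
      ∧ (W166 (j + 1) μ ν (ofRealVec s)).re ≤ (Real.pi ^ 2 / 4) ^ (2 * d + 4) := by
    intro j
    rw [(W166_succ_ofReal j hμν hs ν₀ hν₀).1]
    exact w166_bounds (j + 1) (Nat.le_add_left 1 j) μ ν s (abs_le_pi_of_mem_BZ hs) ν₀ hν₀
  exact ⟨ge_of_tendsto ht (Eventually.of_forall fun j => (hb j).1), le_of_tendsto ht (Eventually.of_forall fun j => (hb j).2)⟩

/-- [our object] Hence `W_∞(μ,ν; s)` IS the real number `Re W_∞(μ,ν; s)` there. -/
theorem W166Inf_ofReal_eq_re {μ ν : Fin d} (hμν : μ ≠ ν) {s : Fin d → ℝ} (hs : s ∈ BZ d) (ν₀ : Fin d) (hν₀ : s ν₀ ≠ 0) :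
    W166Inf μ ν (ofRealVec s) = (((W166Inf μ ν (ofRealVec s)).re : ℝ) : ℂ) := by
  apply Complex.ext
  · simp
  · simp [W166Inf_ofReal_im hμν hs ν₀ hν₀]

/-- [our object] **POSITIVITY ON THE WHOLE REAL ZONE** (`μ ≠ ν`, including `s = 0` where `W_∞ = 1`, `PerfectSymbol166.W166Inf_zero`):
`(4/π²)^{d+2} ≤ Re W_∞(μ,ν; s)` for every `s ∈ [−π,π]^d` — the transverse-coercivity input (P-i) of road FP's H2-P. -/
theorem W166Inf_ofReal_re_lower {μ ν : Fin d} (hμν : μ ≠ ν) {s : Fin d → ℝ} (hs : s ∈ BZ d) :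
    (4 / Real.pi ^ 2) ^ (d + 2) ≤ (W166Inf μ ν (ofRealVec s)).re := by
  by_cases h0 : s = 0
  · subst h0
    have hz : ofRealVec (0 : Fin d → ℝ) = (0 : Fin d → ℂ) := funext fun _ => by simp [ofRealVec]
    rw [hz, W166Inf_zero, Complex.one_re]
    have hπ : (4 / Real.pi ^ 2 : ℝ) ≤ 1 := by
      rw [div_le_one (by positivity)]
      nlinarith [Real.pi_gt_three]
    exact pow_le_one₀ (by positivity) hπ
  · obtain ⟨ν₀, hν₀⟩ : ∃ ν₀, s ν₀ ≠ 0 := by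
      by_contra hall
      push Not at hall
      exact h0 (funext hall)
    exact (W166Inf_ofReal_re_bounds hμν hs ν₀ hν₀).1

/-- [our object] The positivity constant is positive: `0 < (4/π²)^{d+2}`. -/
theorem lower_const_pos : (0 : ℝ) < (4 / Real.pi ^ 2) ^ (d + 2) := by positivity

/-- [our object] **STRICT POSITIVITY**: `0 < Re W_∞(μ,ν; s)` on the real zone, `μ ≠ ν`. -/
theorem W166Inf_ofReal_re_pos {μ ν : Fin d} (hμν : μ ≠ ν) {s : Fin d → ℝ} (hs : s ∈ BZ d) :
    0 < (W166Inf μ ν (ofRealVec s)).re :=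
  lt_of_lt_of_le lower_const_pos (W166Inf_ofReal_re_lower hμν hs)

end Summit.QuantumFields.BalabanUV.Beta.FP.PerfectSymbol166Pos

end
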